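import Mathlib
import Literature.RingTheory.CentralSimple.MaximalCommutativeSemisimpleSubalgebra
import HarnessLib

/-!
# An involution-stable maximal subfield ∕ self-centralizing commutative subalgebra of an algebra with
# (anti-)involution (Cimprič 2008, Lemma 5; the algebra behind Milne, *Complex Multiplication*, Ch. I §3
# Exercise 3.10 (b) for a general simple `L`)

Family `hodge`, lane `lit-hodgefound` (Track 2 foundations library, Layer A3), skeleton seat `skel-3`, generation 62,
row **A3-G147** (FILE 1 of 3: the pure algebra of «stabilized by `′`»). Layer `Literature/RingTheory/CentralSimple`,
namespace `Literature.RingTheory.CentralSimple.AntiInvolution`. THEOREMS ONLY (no definition, no instance, no named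
fact, no notation; D-0026, net debt 0); Mathlib, plus the tree's Bourbaki VIII §14 n°6 Prop. 3 file
`MaximalCommutativeSemisimpleSubalgebra` for the degree clause of §3.

## Source, verbatim

J. Cimprič, *Formally real involutions on central simple algebras*, Comm. Algebra **36** (2008) 165–178
(arXiv:0807.5017; held text `paper:arxiv-0807.5017`, chunk p0005 L12–L28), §2, for a central division algebra `D`
over a field of characteristic `0` with an involution `∗`:

> **Lemma 5.** For every involution `∗` on `D` there exists a maximal (i.e. self-centralizing) subfield of `D`
> which is `∗`-invariant.
>
> *Proof.* We need the following claim: A central simple algebra with involution in which every normal element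
> is central is a field. […] Pick any element `a ∈ A`. The element `α = a + a∗` is symmetric, hence normal. […]
> Suppose now that `L` is a `∗`-subfield of a division algebra `D` which is not contained in any other
> `∗`-subfield. Its centralizer `A = C_D(L)` is also `∗`-invariant and it contains `L`. […] If `A ≠ L`, then `A`
> contains a noncentral normal element `d` by the claim. Then `L(d, d∗)` is also a `∗`-subfield of `D` properly
> containing `L`, contrary to the choice of `L`. Therefore `A = L`.

The consumer is J. S. Milne, *Complex Multiplication* (2006∕2020) [MilneCM2006], Ch. I §3 p. 29, **Exercise 3.10
(b)** «Let `′` be a Rosati involution on `End⁰(A)` stabilizing `L`; show that, if `A` has complex multiplication,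
then there is an `R` as in (a) that is stabilized by `′`» (FILE 2 `RingTheory/SimpleModule/CommutantAdjointStableMaximalEtale`,
FILE 3 `NumberTheory/ComplexMultiplication/CMAlgebraTorusSimpleSubalgebraRosatiStable`).

## What is formalised (a slightly more general form; the deviation from the printed proof is recorded)

Setting: `F` a field with `2 ≠ 0`, `A` a finite-dimensional `F`-algebra (NOT assumed simple, central or a division
algebra), `σ : A →ₗ[F] A` an `F`-linear ANTI-INVOLUTION: `σ (x * y) = σ y * σ x` and `σ (σ x) = x`.

* §1 tools: `map_one` (`σ 1 = 1`), `map_algebraMap`, `adjoin_stable` (a subalgebra generated by a set that `σ` maps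
  into the subalgebra is `σ`-stable — «`L(d, d∗)` is also a `∗`-subfield»), `centralizer_stable` (the commutant of a
  `σ`-stable set is `σ`-stable — «`C_D(L)` is also `∗`-invariant»), `commute_map_of_forall`.
* §2 ★★ **`exists_le_comm_stable_maximal`** — THE RELATIVE FORM: for a `σ`-stable subalgebra `D ≤ A` and a
  `σ`-stable commutative `E₀ ≤ D` there is a commutative `σ`-stable `M` with `E₀ ≤ M ≤ D` which is SELF-CENTRALIZING
  IN `D` (`x ∈ D` commuting with `M` lies in `M`). Proof = Cimprič's growth argument with «normal element» replaced by
  a symmetric-or-antisymmetric one (cf. his Lemma 6): if `x ∈ D ∖ E` commutes with `E`, then so do `x + σ x`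
  (symmetric) and `x − σ x` (antisymmetric), and not both lie in `E` since `2x` is their sum (`2 ≠ 0`); adjoining
  the one outside `E` gives a larger commutative `σ`-stable subalgebra of `D`; induction on the codimension. This
  form needs neither simplicity nor the double centralizer theorem (deviation from the print, recorded).
* §3 ★ **`exists_comm_stable_centralizer_eq`** (`D = A`, `E₀ = F`): a commutative `σ`-stable `M ≤ A` with
  `Subalgebra.centralizer F M = M`; ★★ **`exists_isField_stable_centralizer_eq`** — LEMMA 5 AS PRINTED for every
  finite-dimensional DIVISION algebra `A` over `F` (any centre; `char F ≠ 2` in place of `0`): a `σ`-STABLE MAXIMAL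
  (self-centralizing) SUBFIELD (`IsField ↥M`; inverses of elements of `M` commute with `M`, so lie in `C_A(M) = M`);
  ★ **`exists_isField_stable_finrank_sq_eq`** — the same with the DEGREE CLAUSE `[M : F]² = [A : F]` when the division
  algebra `A` is CENTRAL over `F` (Cimprič's standing setting «Let `D` be a central division `F`-algebra and `K` a
  maximal subfield of `D`», with `D ⊗_F K ≅ M_n(K)`, `n = [K : F]`), via the tree's Bourbaki VIII §14 n°6 Prop. 3
  `centralizer_eq_iff_finrank_sq_eq` (`C_A(M) = M ⟺ [M : F]² = [A : F]` for commutative semisimple `M`).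

NOT here: characteristic `2`.

## References

* [Cimpric2008FormallyRealInvolutions] J. Cimprič, *Formally real involutions on central simple algebras*, Comm.
  Algebra 36 (2008), no. 1, 165–178, doi:10.1080/00927870701665297, arXiv:0807.5017 — §2 Lemma 5 (and Lemma 6),
  §2 opening paragraph and the paragraph before Prop. 8 (p. 5: `D` central, `K` maximal, `D ⊗_F K ≅ M_n(K)`).
* [BourbakiAlgebreVIII2012] N. Bourbaki, *Algèbre, Chapitre 8* (2012), VIII §14 n°6 Prop. 3 (pp. A VIII.257–259)
  (a commutative semisimple subalgebra of a central simple algebra is self-centralizing iff `[L:K]² = [A:K]`).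
* [MilneCM2006] J. S. Milne, *Complex Multiplication* (course notes, 2006∕2020), Ch. I §3 Exercise 3.10 (b) (p. 29),
  §1 Prop. 1.39 (proof, p. 20: an involution permutes the simple factors).
* [KnusEtAl1998] M.-A. Knus, A. Merkurjev, M. Rost, J.-P. Tignol, *The Book of Involutions*, AMS
  Coll. Publ. 44 (1998), §4.B (4.12)–(4.18) (subfields elementwise invariant under an involution — context only).

## Provenance

Lane `lit-hodgefound`, seat `literature-prover-lit-hodgefound-skel-3-g62-0` (row A3-G147, FILE 1).
-/

noncomputable section

open Module

namespace Literature.RingTheory.CentralSimple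

namespace AntiInvolution

variable {F : Type*} [Field F] {A : Type*} [Ring A] [Algebra F A] (σ : A →ₗ[F] A)

/-! ## §1 Tools for an anti-involution `σ` -/

/-- An anti-involution fixes `1` (`x · σ 1 = σ (1 · σ x) = x` for every `x`; an involution is a ring
anti-automorphism). [cite: KnusEtAl1998, Ch. I §2.A (definition of an involution: anti-automorphism of period 2)] -/
theorem map_one (hmul : ∀ x y, σ (x * y) = σ y * σ x) (hσσ : ∀ x, σ (σ x) = x) : σ 1 = 1 := by
  have h : σ (σ 1) * σ 1 = σ (σ 1) := by rw [← hmul, one_mul]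
  rwa [hσσ, one_mul] at h

/-- An `F`-linear anti-involution fixes the scalars `F · 1`. [cite: KnusEtAl1998, Ch. I §2.A (involutions of the first kind are the identity on `F`)] -/
theorem map_algebraMap (hmul : ∀ x y, σ (x * y) = σ y * σ x) (hσσ : ∀ x, σ (σ x) = x) (c : F) :
    σ (algebraMap F A c) = algebraMap F A c := by
  rw [Algebra.algebraMap_eq_smul_one, map_smul, map_one σ hmul hσσ]

/-- A subalgebra generated by a set which `σ` maps into the subalgebra is `σ`-stable («then `L(d, d∗)` is also a
`∗`-subfield of `D`»). [cite: Cimpric2008FormallyRealInvolutions, §2 Lemma 5 (proof)] -/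
theorem adjoin_stable (hmul : ∀ x y, σ (x * y) = σ y * σ x) (hσσ : ∀ x, σ (σ x) = x) {T : Set A}
    (hT : ∀ x ∈ T, σ x ∈ Algebra.adjoin F T) : ∀ x ∈ Algebra.adjoin F T, σ x ∈ Algebra.adjoin F T := by
  intro x hx
  induction hx using Algebra.adjoin_induction with
  | mem x hx => exact hT x hx
  | algebraMap c => rw [map_algebraMap σ hmul hσσ]; exact Subalgebra.algebraMap_mem _ c
  | add x y _ _ hx hy => rw [map_add]; exact Subalgebra.add_mem _ hx hy
  | mul x y _ _ hx hy => rw [hmul]; exact Subalgebra.mul_mem _ hy hx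

/-- A `σ`-stable set is `σ`-invariant: every element is the image of an element of the set. [folklore] -/
private theorem exists_eq_map_of_stable (hσσ : ∀ x, σ (σ x) = x) {T : Set A} (hT : ∀ x ∈ T, σ x ∈ T) {x : A}
    (hx : x ∈ T) : ∃ y ∈ T, x = σ y :=
  ⟨σ x, hT x hx, (hσσ x).symm⟩

/-- If `x` commutes with every element of a `σ`-stable set `E`, then so does `σ x` («its centralizer
`A = C_D(L)` is also `∗`-invariant»). [cite: Cimpric2008FormallyRealInvolutions, §2 Lemma 5 (proof)] -/
theorem commute_map_of_forall (hmul : ∀ x y, σ (x * y) = σ y * σ x) (hσσ : ∀ x, σ (σ x) = x) {E : Set A}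
    (hE : ∀ m ∈ E, σ m ∈ E) {x : A} (hx : ∀ m ∈ E, x * m = m * x) : ∀ m ∈ E, σ x * m = m * σ x := by
  intro m hm
  have h := hx (σ m) (hE m hm)
  calc σ x * m = σ x * σ (σ m) := by rw [hσσ]
    _ = σ (σ m * x) := (hmul _ _).symm
    _ = σ (x * σ m) := by rw [h]
    _ = σ (σ m) * σ x := hmul _ _
    _ = m * σ x := by rw [hσσ]

/-- The commutant of a `σ`-stable set is `σ`-stable («Its centralizer `A = C_D(L)` is also `∗`-invariant and it
contains `L`»). [cite: Cimpric2008FormallyRealInvolutions, §2 Lemma 5 (proof)] -/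
theorem centralizer_stable (hmul : ∀ x y, σ (x * y) = σ y * σ x) (hσσ : ∀ x, σ (σ x) = x) {T : Set A}
    (hT : ∀ x ∈ T, σ x ∈ T) :
    ∀ x ∈ Subalgebra.centralizer F T, σ x ∈ Subalgebra.centralizer F T := by
  intro x hx
  rw [Subalgebra.mem_centralizer_iff] at hx ⊢
  intro m hm
  exact (commute_map_of_forall σ hmul hσσ hT (fun m hm ↦ (hx m hm).symm) m hm).symm

/-- The subalgebra generated by a set of pairwise commuting elements is commutative. [folklore] -/
private theorem adjoin_comm_of_comm {T : Set A} (hT : ∀ a ∈ T, ∀ b ∈ T, a * b = b * a) :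
    ∀ x ∈ Algebra.adjoin F T, ∀ y ∈ Algebra.adjoin F T, x * y = y * x := by
  intro x hx y hy
  haveI := Algebra.isMulCommutative_adjoin F hT
  exact congrArg Subtype.val
    ((IsMulCommutative.is_comm (M := Algebra.adjoin F T)).comm (⟨x, hx⟩ : Algebra.adjoin F T) ⟨y, hy⟩)

/-! ## §2 The relative form: growing a `σ`-stable commutative subalgebra inside a `σ`-stable `D` -/

section Relative

variable [FiniteDimensional F A]

/-- The induction behind Lemma 5 (on the codimension of `E` in `D`). [cite: Cimpric2008FormallyRealInvolutions, §2 Lemma 5 (proof)] -/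
private theorem exists_le_comm_stable_maximal_aux (h2 : (2 : F) ≠ 0) (hmul : ∀ x y, σ (x * y) = σ y * σ x)
    (hσσ : ∀ x, σ (σ x) = x) (D : Subalgebra F A) (hD : ∀ x ∈ D, σ x ∈ D) :
    ∀ (n : ℕ) (E : Subalgebra F A), E ≤ D → finrank F D - finrank F E = n →
      (∀ x ∈ E, ∀ y ∈ E, x * y = y * x) → (∀ x ∈ E, σ x ∈ E) →
      ∃ M : Subalgebra F A, E ≤ M ∧ M ≤ D ∧ (∀ x ∈ M, ∀ y ∈ M, x * y = y * x) ∧ (∀ x ∈ M, σ x ∈ M) ∧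
        ∀ x ∈ D, (∀ m ∈ M, x * m = m * x) → x ∈ M := by
  intro n
  induction n using Nat.strong_induction_on with
  | _ n ih =>
    intro E hED hn hEc hEσ
    by_cases hmax : ∀ x ∈ D, (∀ m ∈ E, x * m = m * x) → x ∈ E
    · exact ⟨E, le_rfl, hED, hEc, hEσ, hmax⟩
    push Not at hmax
    obtain ⟨x, hxD, hxE, hxnot⟩ := hmax
    have hσxD : σ x ∈ D := hD x hxD
    have hσxE : ∀ m ∈ E, σ x * m = m * σ x := commute_map_of_forall σ hmul hσσ hEσ hxE
    -- a symmetric or antisymmetric element of `D ∖ E` commuting with `E`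
    obtain ⟨y, hyD, hyE, hynot, hyσ⟩ : ∃ y ∈ D, (∀ m ∈ E, y * m = m * y) ∧ y ∉ E ∧ σ y ∈ ({y, -y} : Set A) := by
      by_cases hs : x + σ x ∈ E
      · refine ⟨x - σ x, D.sub_mem hxD hσxD, fun m hm ↦ ?_, fun ha ↦ hxnot ?_, ?_⟩
        · rw [sub_mul, mul_sub, hxE m hm, hσxE m hm]
        · have h2x : x = (2 : F)⁻¹ • ((x + σ x) + (x - σ x)) := by
            rw [show (x + σ x) + (x - σ x) = (2 : F) • x by rw [two_smul]; abel, smul_smul,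
              inv_mul_cancel₀ h2, one_smul]
          rw [h2x]
          exact E.smul_mem (E.add_mem hs ha) _
        · refine Set.mem_insert_of_mem _ (Set.mem_singleton_iff.2 ?_)
          rw [map_sub, hσσ, neg_sub]
      · refine ⟨x + σ x, D.add_mem hxD hσxD, fun m hm ↦ ?_, hs, Set.mem_insert_iff.2 (Or.inl ?_)⟩
        · rw [add_mul, mul_add, hxE m hm, hσxE m hm]
        · rw [map_add, hσσ, add_comm]
    -- `E' = E[y]`
    set E' : Subalgebra F A := Algebra.adjoin F (insert y (E : Set A)) with hE'def
    have hEE' : E ≤ E' := fun m hm ↦ Algebra.subset_adjoin (Set.mem_insert_of_mem _ hm)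
    have hyE' : y ∈ E' := Algebra.subset_adjoin (Set.mem_insert _ _)
    have hE'D : E' ≤ D := Algebra.adjoin_le (Set.insert_subset hyD hED)
    have hE'c : ∀ a ∈ E', ∀ b ∈ E', a * b = b * a := by
      refine adjoin_comm_of_comm fun a ha b hb ↦ ?_
      rcases Set.mem_insert_iff.1 ha with ha' | ha'
      · rcases Set.mem_insert_iff.1 hb with hb' | hb'
        · rw [ha', hb']
        · rw [ha']; exact hyE b hb'
      · rcases Set.mem_insert_iff.1 hb with hb' | hb'
        · rw [hb']; exact (hyE a ha').symm
        · exact hEc a ha' b hb'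
    have hE'σ : ∀ a ∈ E', σ a ∈ E' := by
      refine adjoin_stable σ hmul hσσ fun a ha ↦ ?_
      rcases Set.mem_insert_iff.1 ha with ha' | ha'
      · rw [ha']
        rcases Set.mem_insert_iff.1 hyσ with h | h
        · rw [h]; exact hyE'
        · rw [Set.mem_singleton_iff.1 h]; exact E'.neg_mem hyE'
      · exact hEE' (hEσ a ha')
    -- the codimension drops
    have hlt : finrank F E < finrank F E' := by
      have h : E < E' := lt_of_le_of_ne hEE' fun h ↦ hynot (h ▸ hyE')
      have h' : Subalgebra.toSubmodule E < Subalgebra.toSubmodule E' := Subalgebra.toSubmodule.lt_iff_lt.2 h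
      exact Submodule.finrank_lt_finrank_of_lt h'
    have hle : finrank F E' ≤ finrank F D :=
      Submodule.finrank_mono (Subalgebra.toSubmodule.le_iff_le.2 hE'D)
    have hn' : finrank F D - finrank F E' < n := by omega
    obtain ⟨M, hE'M, hMD, hMc, hMσ, hMmax⟩ := ih _ hn' E' hE'D rfl hE'c hE'σ
    exact ⟨M, hEE'.trans hE'M, hMD, hMc, hMσ, hMmax⟩

/-- ★★ **LEMMA 5, RELATIVE FORM.** Let `σ` be an `F`-linear anti-involution of a finite-dimensional `F`-algebra
`A` (`2 ≠ 0` in `F`), `D ≤ A` a `σ`-stable subalgebra and `E₀ ≤ D` a `σ`-stable commutative subalgebra. Then there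
is a commutative `σ`-STABLE subalgebra `M`, `E₀ ≤ M ≤ D`, which is SELF-CENTRALIZING IN `D`: every element of `D`
commuting with `M` lies in `M` («a `∗`-subfield … not contained in any other `∗`-subfield … Therefore
`A = L`»). [cite: Cimpric2008FormallyRealInvolutions, §2 Lemma 5] -/
theorem exists_le_comm_stable_maximal (h2 : (2 : F) ≠ 0) (hmul : ∀ x y, σ (x * y) = σ y * σ x)
    (hσσ : ∀ x, σ (σ x) = x) (D : Subalgebra F A) (hD : ∀ x ∈ D, σ x ∈ D) (E₀ : Subalgebra F A)
    (hE₀D : E₀ ≤ D) (hE₀c : ∀ x ∈ E₀, ∀ y ∈ E₀, x * y = y * x) (hE₀σ : ∀ x ∈ E₀, σ x ∈ E₀) :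
    ∃ M : Subalgebra F A, E₀ ≤ M ∧ M ≤ D ∧ (∀ x ∈ M, ∀ y ∈ M, x * y = y * x) ∧ (∀ x ∈ M, σ x ∈ M) ∧
      ∀ x ∈ D, (∀ m ∈ M, x * m = m * x) → x ∈ M :=
  exists_le_comm_stable_maximal_aux σ h2 hmul hσσ D hD _ E₀ hE₀D rfl hE₀c hE₀σ

/-- The relative form with `E₀ = F`: every `σ`-stable `D` contains a commutative `σ`-stable subalgebra which is
self-centralizing in `D`. [cite: Cimpric2008FormallyRealInvolutions, §2 Lemma 5] -/
theorem exists_comm_stable_maximal (h2 : (2 : F) ≠ 0) (hmul : ∀ x y, σ (x * y) = σ y * σ x)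
    (hσσ : ∀ x, σ (σ x) = x) (D : Subalgebra F A) (hD : ∀ x ∈ D, σ x ∈ D) :
    ∃ M : Subalgebra F A, M ≤ D ∧ (∀ x ∈ M, ∀ y ∈ M, x * y = y * x) ∧ (∀ x ∈ M, σ x ∈ M) ∧
      ∀ x ∈ D, (∀ m ∈ M, x * m = m * x) → x ∈ M := by
  obtain ⟨M, -, hMD, hMc, hMσ, hMmax⟩ := exists_le_comm_stable_maximal σ h2 hmul hσσ D hD ⊥ bot_le
    (fun x hx y hy ↦ by
      obtain ⟨c, rfl⟩ := Algebra.mem_bot.1 hx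
      exact Algebra.commutes c y)
    (fun x hx ↦ by
      obtain ⟨c, rfl⟩ := Algebra.mem_bot.1 hx
      rw [map_algebraMap σ hmul hσσ]
      exact Subalgebra.algebraMap_mem _ c)
  exact ⟨M, hMD, hMc, hMσ, hMmax⟩

end Relative

/-! ## §3 The absolute forms: a `σ`-stable self-centralizing commutative subalgebra; Lemma 5 for division algebras -/

section Absolute

variable [FiniteDimensional F A]

/-- ★ **A `σ`-stable commutative subalgebra equal to its own commutant**, in every finite-dimensional algebra with
an `F`-linear anti-involution (`2 ≠ 0`). [cite: Cimpric2008FormallyRealInvolutions, §2 Lemma 5] -/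
theorem exists_comm_stable_centralizer_eq (h2 : (2 : F) ≠ 0) (hmul : ∀ x y, σ (x * y) = σ y * σ x)
    (hσσ : ∀ x, σ (σ x) = x) :
    ∃ M : Subalgebra F A, (∀ x ∈ M, ∀ y ∈ M, x * y = y * x) ∧ (∀ x ∈ M, σ x ∈ M) ∧
      Subalgebra.centralizer F (M : Set A) = M := by
  obtain ⟨M, -, hMc, hMσ, hMmax⟩ := exists_comm_stable_maximal σ h2 hmul hσσ ⊤ (fun _ _ ↦ Algebra.mem_top)
  refine ⟨M, hMc, hMσ, le_antisymm (fun x hx ↦ ?_) (fun m hm ↦ ?_)⟩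
  · exact hMmax x Algebra.mem_top fun m hm ↦ ((Subalgebra.mem_centralizer_iff F).1 hx m hm).symm
  · exact (Subalgebra.mem_centralizer_iff F).2 fun x hx ↦ (hMc m hm x hx).symm

end Absolute

section Division

variable {D : Type*} [DivisionRing D] [Algebra F D] [FiniteDimensional F D] (τ : D →ₗ[F] D)

/-- ★★ **LEMMA 5 AS PRINTED (any centre, `char F ≠ 2`): a finite-dimensional division algebra with an `F`-linear
(anti-)involution `τ` has a `τ`-STABLE MAXIMAL (self-centralizing) SUBFIELD** — «For every involution `∗` on `D`
there exists a maximal (i.e. self-centralizing) subfield of `D` which is `∗`-invariant». (`M` is a field: the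
inverse of `0 ≠ m ∈ M` commutes with `M`, hence lies in `C_D(M) = M`.) [cite: Cimpric2008FormallyRealInvolutions, §2 Lemma 5] -/
theorem exists_isField_stable_centralizer_eq (h2 : (2 : F) ≠ 0) (hmul : ∀ x y, τ (x * y) = τ y * τ x)
    (hττ : ∀ x, τ (τ x) = x) :
    ∃ M : Subalgebra F D, IsField M ∧ (∀ x ∈ M, τ x ∈ M) ∧ Subalgebra.centralizer F (M : Set D) = M := by
  obtain ⟨M, hMc, hMτ, hMcent⟩ := exists_comm_stable_centralizer_eq τ h2 hmul hττ
  refine ⟨M, ?_, hMτ, hMcent⟩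
  -- inverses: `m⁻¹ ∈ C_D(M) = M`
  have hinv : ∀ m ∈ M, m⁻¹ ∈ M := by
    intro m hm
    rw [← hMcent, Subalgebra.mem_centralizer_iff]
    intro x hx
    by_cases hm0 : m = 0
    · rw [hm0, inv_zero, mul_zero, zero_mul]
    · have h := hMc m hm x hx
      calc x * m⁻¹ = m⁻¹ * (m * x) * m⁻¹ := by rw [← mul_assoc, inv_mul_cancel₀ hm0, one_mul]
        _ = m⁻¹ * (x * m) * m⁻¹ := by rw [h]
        _ = m⁻¹ * x := by rw [mul_assoc, mul_assoc, mul_inv_cancel₀ hm0, mul_one]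
  refine { exists_pair_ne := ⟨0, 1, zero_ne_one⟩, mul_comm := fun a b ↦ Subtype.ext (hMc a a.2 b b.2),
           mul_inv_cancel := fun {a} ha ↦ ⟨⟨(a : D)⁻¹, hinv a a.2⟩, Subtype.ext ?_⟩ }
  have ha0 : (a : D) ≠ 0 := fun h ↦ ha (Subtype.ext h)
  exact mul_inv_cancel₀ ha0

omit [FiniteDimensional F D] in
/-- The `τ`-stable maximal subfield contains the centre of `D`. [cite: Cimpric2008FormallyRealInvolutions, §2 Lemma 5 (proof: «it contains `L`»)] -/
theorem center_le_of_centralizer_eq (M : Subalgebra F D) (hM : Subalgebra.centralizer F (M : Set D) = M) :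
    Subalgebra.center F D ≤ M := by
  intro z hz
  rw [← hM, Subalgebra.mem_centralizer_iff]
  exact fun m _ ↦ Subalgebra.mem_center_iff.1 hz m

open scoped IsMulCommutative in
/-- ★ **Lemma 5 with its degree clause, for a CENTRAL division algebra (`char F ≠ 2`): a `τ`-stable maximal
(self-centralizing) subfield `M` of `D`, and `[M : F]² = [D : F]`** — Cimprič's standing setting «Let `D` be a
central division `F`-algebra and `K` a maximal subfield of `D`. Every involution `∗` on `D` such that `K∗ ⊆ K`
extends to an involution on `D ⊗_F K`», «Let `K` be a maximal subfield of a division algebra `D` and `e₁, …, eₙ` a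
right `K`-basis of `D` […] `D ⊗_F K → M_n(K)` […] is an isomorphism» (so `[D : F] = n²`, `n = [K : F]`). The degree
is read off `C_D(M) = M` by Bourbaki's Prop. 3 (`M` is commutative and, being a field, semisimple).
[cite: Cimpric2008FormallyRealInvolutions, §2 Lemma 5 and the paragraph before Prop. 8] [cite: BourbakiAlgebreVIII2012, VIII §14 n°6 Prop. 3 (i)⟺(iii) (pp. A VIII.257–259)] -/
theorem exists_isField_stable_finrank_sq_eq [Algebra.IsCentral F D] (h2 : (2 : F) ≠ 0)
    (hmul : ∀ x y, τ (x * y) = τ y * τ x) (hττ : ∀ x, τ (τ x) = x) :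
    ∃ M : Subalgebra F D, IsField M ∧ (∀ x ∈ M, τ x ∈ M) ∧ Subalgebra.centralizer F (M : Set D) = M ∧
      finrank F ↥M ^ 2 = finrank F D := by
  obtain ⟨M, hMF, hMτ, hMcent⟩ := exists_isField_stable_centralizer_eq τ h2 hmul hττ
  haveI : IsMulCommutative ↥M := ⟨⟨fun a b ↦ hMF.mul_comm a b⟩⟩
  haveI : IsReduced ↥M := inferInstance
  haveI : IsArtinianRing ↥M := IsArtinianRing.of_finite F ↥M
  haveI : IsSemisimpleRing ↥M := IsArtinianRing.isSemisimpleRing_of_isReduced ↥M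
  exact ⟨M, hMF, hMτ, hMcent, (centralizer_eq_iff_finrank_sq_eq M).1 hMcent⟩

end Division

end AntiInvolution

end Literature.RingTheory.CentralSimple
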